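import Summits.BirchSwinnertonDyer.BirchSwinnertonDyer.Theorems.CyclotomicUntwistSigmaLineFamilyLineData
import Summits.BirchSwinnertonDyer.BirchSwinnertonDyer.Theorems.CyclotomicUntwistSigmaLineFamilyHeightDatumUnique
import HarnessLib

/-!
# D5 CANDIDATE (crux workfile, NOT a Theorems file): «the ψ-line height IS the σ-line height of constant c_ψ»
# — a typed canonicity predicate for D2 `PSLineHeightData` in the tree's PRESENT vocabulary

Seat bsd-line-cycu-p1 g4, crux K1 `PSRankOneLowerHalfAtThree` (stmt-BirchSwinnertonDyer-21580). This file is a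
PROPOSAL for the pen / the D5 typer (`defn-PSCanonicalSelmerHeight`, verdict NOT TYPED): it shows that the
canonicity predicate the separated K1 ∧ K2 glue needs (`Can W η α Dh`) can be TYPED TODAY over the landed
σ-line family theorems, with exactly ONE untyped number left — the line constant `c_ψ ∈ R = ℚ₃(ζ₃)` (the
descended-Frobenius eigenline parameter of cycu-p3 g4 GZ3-NUMERIC-TEST-v2 §5; cycu-p3 g5 LAW L-a3). BSD is not
proved by any of this; nothing here is asserted as a fact; the two `def`s below are CANDIDATE TEXTS.

* `IsSigmaLineHeightAt W c₀ a b Dh` — `Dh : PSLineHeightData W R` agrees, on every line `χ` and every deep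
  admissible rational point, with the σ-line height of constant `c_χ := ι a + ι b·χ(2)` read from the integral
  reference member `σ_{c₀}` (`c₀ ∈ ℤ₃`):
  `Dh.pairing χ P P = ι(h_{σ_{c₀}}(P)) + (c_χ − ι c₀)·ι(log_W z(P))²`.
  INHABITED for every `(c₀, a, b)` (`PSSigmaLineFamilyLineData.exists_psLineHeightData`), reference-independent
  (`sigmaHeight_affine_extension_eq`), and DICH holds for it outright when `b ≠ 0`
  (`PSSigmaLineFamilyLineDataDichotomy.both_ne_zero_of_spec`, in flight p613441).
* `IsPsiLineHeight W cψ Dh` — the same keyed on the single number `c_ψ = a + bζ₃` (existential over the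
  reference `c₀` and the rational coordinates `a, b` of `c_ψ` in the basis `1, ψ(2)`).

What D5 would then SAY (pen's choice): `Can W η α Dh := IsPsiLineHeight W (cψ W η α) Dh` with `cψ` THE
eigenline parameter — the only place where p-adic Hodge theory enters, as ONE element of `ℚ₃(ζ₃)` per row
(numerically pinned on 405c1/648b1/648d1/405d1/324c1 by cycu-p3 g4).
-/

set_option linter.dupNamespace false

noncomputable section

open scoped Classical

open WeierstrassCurve Literature.NumberTheory.EllipticCurves
  Summit.BirchSwinnertonDyer.Rank1Residual.Additive

namespace Summit.BirchSwinnertonDyer.BirchSwinnertonDyer.Cruxes.PSRankOneLowerHalfAtThree.D5Candidate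

variable (W : WeierstrassCurve ℚ) {R : Type*} [CommRing R] [Algebra ℚ_[3] R]

/-- CANDIDATE TEXT 1: `Dh` is the σ-line height datum with reference constant `c₀ ∈ ℤ₃` and line constants
`c_χ = ι a + ι b·χ(2)`, on the deep admissible locus (`‖x‖₃ > 1`, `‖z‖₃ ≤ 3⁻³`, non-singular reduction at
every prime). -/
def IsSigmaLineHeightAt (c₀ a b : ℚ_[3]) (Dh : W.PSLineHeightData R) : Prop :=
  ∀ (χ : DirichletCharacter R 9), χ ^ 3 = 1 → χ ≠ 1 →
    ∀ {x y : ℚ} (h : W.toAffine.Nonsingular x y),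
      1 < ‖(x : ℚ_[3])‖ → ‖(-(x : ℚ_[3]) / (y : ℚ_[3]))‖ ≤ ((3 : ℝ)⁻¹) ^ 3 →
        (∀ ℓ : ℕ, ℓ.Prime → W.HasNonsingularReductionAt ℓ x y) →
          Dh.pairing χ (.some x y h) (.some x y h) =
            algebraMap ℚ_[3] R (CensusX42.sigmaHeight W 3 ((W.baseChange ℚ_[3]).formalSigma c₀) (.some x y h)) +
              (algebraMap ℚ_[3] R a + algebraMap ℚ_[3] R b * χ 2 - algebraMap ℚ_[3] R c₀) *
                algebraMap ℚ_[3] R (padicEval (W.baseChange ℚ_[3]).formalLog (-(x : ℚ_[3]) / (y : ℚ_[3]))) ^ 2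

/-- CANDIDATE TEXT 2 (the D5 shape): `Dh` is THE `ψ`-line height datum of the line `ψ` with constant
`cψ ∈ R`: for some integral reference `c₀` and rational coordinates `a, b` with `cψ = ι a + ι b·ψ(2)`, `Dh`
is the σ-line height datum `IsSigmaLineHeightAt W c₀ a b Dh`. -/
def IsPsiLineHeight (ψ : DirichletCharacter R 9) (cψ : R) (Dh : W.PSLineHeightData R) : Prop :=
  ∃ c₀ a b : ℚ_[3], ‖c₀‖ ≤ 1 ∧ cψ = algebraMap ℚ_[3] R a + algebraMap ℚ_[3] R b * ψ 2 ∧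
    IsSigmaLineHeightAt W c₀ a b Dh

/-- INHABITED: for `W` globally minimal (elliptic) every candidate class is non-empty (landed
`exists_psLineHeightData`). -/
theorem exists_isSigmaLineHeightAt [W.IsElliptic] [W.IsGloballyMinimal] {c₀ : ℚ_[3]} (hc₀ : ‖c₀‖ ≤ 1)
    (a b : ℚ_[3]) : ∃ Dh : W.PSLineHeightData R, IsSigmaLineHeightAt W c₀ a b Dh := by
  obtain ⟨Dh, hDh⟩ :=
    Summit.BirchSwinnertonDyer.BirchSwinnertonDyer.Theorems.PSSigmaLineFamilyLineData.exists_psLineHeightData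
      (R := R) W hc₀ a b
  exact ⟨Dh, fun χ h3 h1 x y h hx hz hns => hDh χ h3 h1 h hx hz hns⟩

/-- INHABITED (D5 shape): for every line `ψ` and every `cψ` of the form `ι a + ι b·ψ(2)`. -/
theorem exists_isPsiLineHeight [W.IsElliptic] [W.IsGloballyMinimal] (ψ : DirichletCharacter R 9) (a b : ℚ_[3]) :
    ∃ Dh : W.PSLineHeightData R, IsPsiLineHeight W ψ (algebraMap ℚ_[3] R a + algebraMap ℚ_[3] R b * ψ 2) Dh := by
  obtain ⟨Dh, hDh⟩ := exists_isSigmaLineHeightAt W (R := R) (c₀ := 0) (by simp) a b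
  exact ⟨Dh, 0, a, b, by simp, rfl, hDh⟩

end Summit.BirchSwinnertonDyer.BirchSwinnertonDyer.Cruxes.PSRankOneLowerHalfAtThree.D5Candidate

end
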